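/-
Copyright: statement-level skeleton of a published paper (lit-balaban cell, Phase-2 proof seat p25, gen 17). No proof
claims beyond what the kernel checks below.
-/
import Literature.MathematicalPhysics.QuantumFieldTheory.BalabanImbrieJaffe1984to88.BIJ88LabelledTermCount312

/-!
# `BalabanImbrieJaffe1984to88.BIJ88LabelledSumBounds312` — T. Bałaban, J. Imbrie, A. Jaffe, *Effective action and cluster
properties of the abelian Higgs model*, Commun. Math. Phys. **114** (1988) 257–315 [BalabanImbrieJaffe1988], §5.14
p. 312 [PDF 56]: *"Summing all possible diagrams in X_c gives the observable for the next step there, F^L_{k+1,loc}(X_c).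
Summing all terms in X_r gives an observable F_{k,rem}(X_r)."* and *"The main source of concern in estimating G_k(X_{r′})
is that we only have bounds |F_{k,loc}(X_{σ_i})| ≤ c(L^kε)^{−m(c)}e^{−m′(c)}, coming from our estimates on perturbation
expansions of observables similarly for F_{k+1,loc}(X_c). … By performing sufficiently many integrations by parts, we
have arranged for enough small factors to beat these large factors in the remainder terms"* — **THE FIRST BOUNDS ON THE
SUMS `F^L`, `F_{k,rem}` IN THE LABELLED CURRENCY.**  With the per-term bounds of `BIJ88LabelledCoefBound312` and the term
counts / sizes of `BIJ88LabelledTermCount312` (p25 gen 17): the constant component of one observable's run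
`|fl i B| ≤ (W·max B 1)^{rpot}` and the constant-component sums `|cst C| ≤ (W·max B 1)^{Φ₀(C)}` (*"bounds … coming from
our estimates on perturbation expansions of observables"* — here the crude ones: LARGE FACTORS), and the remainder
observable `|remv(O)| ≤ (W·max B 1)^{Φ₀(O)} · max(c_M^{M}·G, G_s·√μ(Sh))` — LARGE FACTORS TIMES ONE SMALL FACTOR, the
content of *"enough small factors to beat these large factors in the remainder terms"* at the level this bookkeeping
reaches (whether the small factor wins is a matter of the sizes of `c_M`, `μ(Sh)` against `(W·max B 1)^{Φ₀}·G`, not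
decided here).

statement-level skeleton of published theorems with citation tags; proofs where landed; nothing here is a claim
about the Yang–Mills mass gap

PDF held: `paper:balaban1988-cmp114-bij-abelian-higgs-effective-action` (journal page = PDF page + 256); p. 312 =
PDF 56 (`p0056.txt` L3–5 / L20–25 re-read this session; the quoted sentences are verbatim there up to the OCR of
sub/superscripts; the ellipsis omits L22–23 *"Here m(c), m′(c) depend on the terms in F in X_{σ_i} or X_c."*).

CITATION HEADER (lean-in-tree rule).  lit-balaban cell (HOME `run/shared/lean/pub/lit-balaban/`), Phase 2, seat p25
gen 17; row **C2.Claim@312** of `HOME/lit-balaban-r16/ROWS-C2-part2.md` (owner r16, referee ref-5; head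
`BIJ88Sect5StatementsPart4.Ineq312` NOT touched — a MEMBER next to `BIJ88LabelledCoefBound312`/`BIJ88LabelledTermCount312`).
USED BY NAME, nothing restated: `BIJ88Resummation312` (`cst`, `fl`, `remv`), `BIJ88LabelledCoefBound312`
(`run_coef_bound`, `expand_coef_bound_init`, `remainder_term_bound`, `dirs_ne_nil_of_card_pos`),
`BIJ88LabelledTermCount312` (`run_wcount_le`, `card_expand_le`, `card_expand_zero_le`, `expand_size_le`, `expand_dir`,
`groups_ne_zero_of_consts_eq_zero`), `BIJ88LabelledRemainderCount312.remainder_components_count`,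
`BIJ88LabelledExpansion311` (`expand`, `gintM`, `tval`), `BIJ88LabelledRun311` (`run`, `rpot`, `pristine`).

## What is proved (0 `sorry`, standard axioms, no definitions, no `Prop` facts)

* **`abs_fl_le`** (`|fl i B| ≤ (W·max B 1)^{rpot(pristine i, B, ∅)}`), **`abs_cst_le`** (`|cst C| ≤ (W·max B 1)^{Φ₀(C)}`),
  **`abs_remv_le`** (`O ≠ ∅`: `|remv [] 0 O| ≤ (W·max B 1)^{Φ₀(O)} · max(c_M^{M}·G, G_s·√μ(Sh))`), for any
  `W ≥ Φ₀ + Σ_m|legs m|`, brackets on `Dir` bounded by `B`, couplings `|c_m| ≤ c_M ≤ 1`.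
HONEST SCOPE: as in the siblings — contraction-graph components, one covariance of unrestricted range, no geometry; the
counts are crude (`W` grows with the number of observables, so `(W·max B 1)^{Φ₀}` is factorial-like in `|O|`; print's
locality is not available here); ONE small factor per TERM of `remv(O)` (a vertex-saturated remainder component gives
`c_M^{M}`, a `χ′`-component the global shell factor `√μ(Sh)` — not one per remainder component); the large-factor
hypotheses `hG`/`hGs` quantify only over leg multisets in `Dir` and direction lists in `A⁻¹Dir` of total size `≤ Φ₀(O)`
(finitely many when `Dir` is finite, so they are satisfiable); `G`, `G_s`, `K_D`, `μ(Sh)` are not estimated.  CURRENCY: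
feeds none of `BIJ88Sect5StatementsPart4.Ineq312` / `hobs` / `RemainderComponent` by name — the p. 312 estimate (decay in
`|X_r|`) stays the row's open head question.  NOT summit progress; NOT continuum; NOT Clay.  Imports
`BIJ88LabelledTermCount312` only; modifies nothing.
-/

noncomputable section

namespace Literature.MathematicalPhysics.QuantumFieldTheory.BalabanImbrieJaffe1984to88.BIJ88LabelledSumBounds312

open Classical MeasureTheory Matrix Finset
open scoped BigOperators ContDiff
open Literature.MathematicalPhysics.QuantumFieldTheory.Balaban1983to89
open B2Eq228Conditioning (weight source)
open BIJ88VertexIbp311 (lmono vexp)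
open BIJ88WickDerivatives305 (dlist)
open BIJ88VertexComponents311 (Grp maxArity)
open BIJ88LabelledRun311 BIJ88LabelledRunEnv311 BIJ88LabelledExpansion311 BIJ88LabelledRemainderCount312
open BIJ88Resummation312 (cst fl remv)
open BIJ88LabelledCoefBound312 BIJ88LabelledTermCount312

variable {S : Type} [Fintype S] [DecidableEq S] {ι : Type} [Fintype ι] {κ : Type} [LinearOrder κ]
variable {A : Matrix S S ℝ} {f : S → ℝ} {c : ι → ℝ} {legs : ι → List (S → ℝ)} {obs : κ → List (S → ℝ)} {M : ℕ}
  {Dir : Set (S → ℝ)} {B cM : ℝ}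

omit [Fintype S] [DecidableEq S] [Fintype ι] [LinearOrder κ] in
/-- The legs of a family of components, counted (bookkeeping). [folklore] -/
private theorem card_sum_coe (gs : Multiset (LGrp S κ)) :
    Multiset.card ((gs.map fun h => (h.pend : Multiset (S → ℝ))).sum) = (gs.map fun h => h.pend.length).sum := by
  induction gs using Multiset.induction_on with
  | empty => simp
  | cons g gs ih =>
    rw [Multiset.map_cons, Multiset.sum_cons, Multiset.card_add, ih, Multiset.map_cons, Multiset.sum_cons,
      Multiset.coe_card]

omit [Fintype S] [DecidableEq S] [Fintype ι] [LinearOrder κ] in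
/-- A leg of a family of components is a leg of one of them (bookkeeping). [folklore] -/
private theorem mem_sum_coe {gs : Multiset (LGrp S κ)} {w : S → ℝ}
    (hw : w ∈ (gs.map fun h => (h.pend : Multiset (S → ℝ))).sum) : ∃ h ∈ gs, w ∈ h.pend := by
  induction gs using Multiset.induction_on with
  | empty => simp at hw
  | cons g gs ih =>
    rw [Multiset.map_cons, Multiset.sum_cons, Multiset.mem_add] at hw
    rcases hw with hw | hw
    · exact ⟨g, Multiset.mem_cons_self _ _, Multiset.mem_coe.1 hw⟩
    · obtain ⟨h, hh, hw⟩ := ih hw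
      exact ⟨h, Multiset.mem_cons_of_mem hh, hw⟩

omit [Fintype S] [DecidableEq S] [Fintype ι] [LinearOrder κ] in
/-- A sum over a multiset of terms each bounded by `b` is at most `#terms · b` (bookkeeping). [folklore] -/
private theorem abs_sum_map_le_card_mul {X : Type} (s : Multiset X) (v : X → ℝ) {b : ℝ} (hb : ∀ x ∈ s, |v x| ≤ b) :
    |(s.map v).sum| ≤ Multiset.card s * b := by
  refine (Multiset.abs_sum_le_sum_abs).trans ?_
  rw [Multiset.map_map]
  refine (Multiset.sum_map_le_sum_map _ (fun _ => b) fun x hx => hb x hx).trans (le_of_eq ?_)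
  rw [Multiset.map_const', Multiset.sum_replicate, nsmul_eq_mul]

omit [Fintype S] [DecidableEq S] [Fintype ι] [LinearOrder κ] in
/-- A sub-multiset has fewer elements, as a real inequality (bookkeeping). [folklore] -/
private theorem card_filter_le_real {X : Type} (s : Multiset X) (p : X → Prop) [DecidablePred p] :
    (Multiset.card (s.filter p) : ℝ) ≤ Multiset.card s := by
  exact_mod_cast Multiset.card_le_card (Multiset.filter_le p s)

/-- **THE CONSTANT COMPONENT OF ONE OBSERVABLE'S RUN IS BOUNDED BY LARGE FACTORS** (p. 312 *"bounds … coming from our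
estimates on perturbation expansions of observables similarly for F^L_{k+1,loc}(X_c)"*, the crude version):
`|fl i B| ≤ (W · max B 1)^{rpot(pristine i, B)}` for `W ≥ rpot + Σ_m|legs m|` (at most `W^{rpot}` outcomes, each a
product of at most `rpot` brackets `≤ max B 1` and couplings `≤ c_M ≤ 1`). [cite: BalabanImbrieJaffe1988, §5.14 p.312] -/
theorem abs_fl_le (hB : ∀ u ∈ Dir, ∀ v ∈ Dir, |(A⁻¹ *ᵥ u) ⬝ᵥ v| ≤ B) (hBf : ∀ u ∈ Dir, |(A⁻¹ *ᵥ u) ⬝ᵥ f| ≤ B)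
    (hcM : 0 ≤ cM) (hcM1 : cM ≤ 1) (hcm : ∀ m, |c m| ≤ cM)
    (hobs : ∀ j, ∀ w ∈ obs j, w ∈ Dir) (hlegs : ∀ m, ∀ w ∈ legs m, w ∈ Dir) (i : κ) (Bs : Finset κ) {W : ℕ}
    (hW : rpot obs M (maxArity legs) (pristine obs i) Bs 0 + ∑ m, (legs m).length ≤ W) :
    |fl A f c legs obs M i Bs| ≤ ((W : ℝ) * max B 1) ^ rpot obs M (maxArity legs) (pristine obs i) Bs 0 := by
  have hm : 1 ≤ max B 1 := le_max_right B 1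
  have hm0 : 0 < max B 1 := zero_lt_one.trans_le hm
  unfold fl
  -- each outcome: |a_o| ≤ (max B 1)^{rpot}
  have hterm : ∀ o ∈ (run A f c legs obs M (pristine obs i) Bs 0).filter (fun o => o.g.IsConst M ∧ o.rest = ∅),
      |o.a| ≤ (max B 1) ^ rpot obs M (maxArity legs) (pristine obs i) Bs 0 := by
    intro o ho
    have ho' := (Multiset.mem_filter.1 ho).1
    have h := run_coef_bound hB hBf hcM hcm hobs hlegs _ _ _ o ho' (hobs i)
      (fun h hh => absurd hh (Multiset.notMem_zero _))
    have h1 : |o.a| ≤ |o.a| * (max B 1) ^ rpot obs M (maxArity legs) o.g o.rest o.done :=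
      le_mul_of_one_le_right (abs_nonneg _) (one_le_pow₀ hm)
    exact h1.trans (h.trans (mul_le_of_le_one_right (pow_nonneg hm0.le _) (pow_le_one₀ hcM hcM1)))
  refine (abs_sum_map_le_card_mul _ _ hterm).trans ?_
  -- the number of outcomes: at most W^{rpot}
  have hcount : (Multiset.card ((run A f c legs obs M (pristine obs i) Bs 0).filter
      (fun o => o.g.IsConst M ∧ o.rest = ∅)) : ℝ) ≤ (W : ℝ) ^ rpot obs M (maxArity legs) (pristine obs i) Bs 0 := by
    refine (card_filter_le_real _ _).trans ?_
    have hR1 : 1 ≤ rpot obs M (maxArity legs) (pristine obs i) Bs 0 := by simp only [rpot]; omega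
    have hW0 : 0 < W := by omega
    have h := run_wcount_le (A := A) (f := f) (c := c) _ (pristine obs i) Bs 0 (Nat.lt_succ_self _) W hW
    -- each outcome weighs at least 1
    have h1 : Multiset.card (run A f c legs obs M (pristine obs i) Bs 0)
        ≤ ((run A f c legs obs M (pristine obs i) Bs 0).map
            fun o => W ^ rpot obs M (maxArity legs) o.g o.rest o.done).sum := by
      have := Multiset.card_nsmul_le_sum (s := (run A f c legs obs M (pristine obs i) Bs 0).map
        fun o => W ^ rpot obs M (maxArity legs) o.g o.rest o.done) (a := 1) (fun x hx => by
          obtain ⟨o, -, rfl⟩ := Multiset.mem_map.1 hx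
          exact Nat.one_le_pow _ _ hW0)
      rwa [Multiset.card_map, smul_eq_mul, mul_one] at this
    exact_mod_cast h1.trans h
  exact (mul_le_mul_of_nonneg_right hcount (pow_nonneg hm0.le _)).trans (le_of_eq (by rw [mul_pow]))

/-- **THE CONSTANT-COMPONENT SUMS ARE BOUNDED BY LARGE FACTORS** (p. 312, *"F^L_{k+1,loc}(X_c)"* bounds, crude
version): `|cst C| ≤ (W · max B 1)^{Φ₀(C)}` for `W ≥ Φ₀(C) + Σ_m|legs m|`, `Φ₀(C) = Σ_{j∈C}(|obs j|+1+M·maxArity)`.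
[cite: BalabanImbrieJaffe1988, §5.14 p.312] -/
theorem abs_cst_le (hB : ∀ u ∈ Dir, ∀ v ∈ Dir, |(A⁻¹ *ᵥ u) ⬝ᵥ v| ≤ B) (hBf : ∀ u ∈ Dir, |(A⁻¹ *ᵥ u) ⬝ᵥ f| ≤ B)
    (hcM : 0 ≤ cM) (hcM1 : cM ≤ 1) (hcm : ∀ m, |c m| ≤ cM)
    (hobs : ∀ j, ∀ w ∈ obs j, w ∈ Dir) (hlegs : ∀ m, ∀ w ∈ legs m, w ∈ Dir) (C : Finset κ) {W : ℕ}
    (hW : ∑ j ∈ C, ((obs j).length + 1 + M * maxArity legs) + ∑ m, (legs m).length ≤ W) :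
    |cst A f c legs obs M C| ≤ ((W : ℝ) * max B 1) ^ ∑ j ∈ C, ((obs j).length + 1 + M * maxArity legs) := by
  have hm : 1 ≤ max B 1 := le_max_right B 1
  have hm0 : 0 < max B 1 := zero_lt_one.trans_le hm
  unfold cst
  have hterm : ∀ t ∈ (expand A f c legs obs M 0 C).filter (fun t => t.groups = 0),
      |t.coef| ≤ (max B 1) ^ ∑ j ∈ C, ((obs j).length + 1 + M * maxArity legs) := fun t ht =>
    (expand_coef_bound_init hB hBf hcM hcm hobs hlegs C t (Multiset.mem_filter.1 ht).1).trans
      (mul_le_of_le_one_right (pow_nonneg hm0.le _) (pow_le_one₀ hcM hcM1))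
  refine (abs_sum_map_le_card_mul _ _ hterm).trans ?_
  have hcount : (Multiset.card ((expand A f c legs obs M 0 C).filter (fun t => t.groups = 0)) : ℝ)
      ≤ (W : ℝ) ^ ∑ j ∈ C, ((obs j).length + 1 + M * maxArity legs) := by
    refine (card_filter_le_real _ _).trans ?_
    have h := card_expand_le (A := A) (f := f) (c := c) (legs := legs) (obs := obs) (M := M) _ 0 C
      (Nat.lt_succ_self _) W
    rw [Multiset.map_zero, Multiset.sum_zero, zero_add] at h
    exact_mod_cast h hW
  exact (mul_le_mul_of_nonneg_right hcount (pow_nonneg hm0.le _)).trans (le_of_eq (by rw [mul_pow]))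

/-- **THE REMAINDER OBSERVABLE IS LARGE FACTORS TIMES ONE SMALL FACTOR** (p. 312 *"By performing sufficiently many
integrations by parts, we have arranged for enough small factors to beat these large factors in the remainder terms"*,
at the level of this bookkeeping): for `O ≠ ∅`, cutoff `χ ∈ C^∞` with `χ′ = 0` off the closed shell `Sh`,
`A ≻ 0`, brackets on `Dir` bounded by `B`, couplings `|c_m| ≤ c_M ≤ 1`, and LARGE-FACTOR bounds `G`, `G_s` for the
Gaussian integrals `|∫Π_PΦ·(Π_D∂)χ·e^{−V}dμ|`, resp. the moments `√(∫(Π_PΦ)²dμ)·K_D` (`D ≠ []`), over the leg multisets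
`P ⊆ Dir` and direction lists `D ⊆ A⁻¹Dir` of total size `≤ Φ₀(O)` (all that can occur, `expand_size_le`/`expand_dir`):
`|remv [] 0 O| ≤ (W · max B 1)^{Φ₀(O)} · max(c_M^{M}·G, G_s·√μ(Sh))` for `W ≥ Φ₀(O) + Σ_m|legs m|` — every term has a
remainder component (`groups_ne_zero_of_consts_eq_zero`), hence `M` couplings of a vertex-saturated one or a `χ′` under
its integral (`remainder_term_bound`). [cite: BalabanImbrieJaffe1988, §5.14 p.312] -/
theorem abs_remv_le (hA : A.PosDef) {χ : (S → ℝ) → ℝ} (hχ : ContDiff ℝ ∞ χ) {Kd : List (S → ℝ) → ℝ}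
    (hK : ∀ D φ, |dlist D χ φ * vexp c legs φ| ≤ Kd D) {Sh : Set (S → ℝ)} (hSh : IsClosed Sh)
    (hχS : ∀ φ, φ ∉ Sh → fderiv ℝ χ φ = 0)
    (hB : ∀ u ∈ Dir, ∀ v ∈ Dir, |(A⁻¹ *ᵥ u) ⬝ᵥ v| ≤ B) (hBf : ∀ u ∈ Dir, |(A⁻¹ *ᵥ u) ⬝ᵥ f| ≤ B)
    (hcM : 0 ≤ cM) (hcM1 : cM ≤ 1) (hcm : ∀ m, |c m| ≤ cM)
    (hobs : ∀ j, ∀ w ∈ obs j, w ∈ Dir) (hlegs : ∀ m, ∀ w ∈ legs m, w ∈ Dir) {O : Finset κ} (hO : O.Nonempty) {W : ℕ}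
    (hW : ∑ j ∈ O, ((obs j).length + 1 + M * maxArity legs) + ∑ m, (legs m).length ≤ W) {G Gs : ℝ} (hG0 : 0 ≤ G)
    (hG : ∀ (P : Multiset (S → ℝ)) (D : List (S → ℝ)), (∀ w ∈ P, w ∈ Dir) → (∀ z ∈ D, ∃ u ∈ Dir, A⁻¹ *ᵥ u = z) →
      Multiset.card P + D.length ≤ ∑ j ∈ O, ((obs j).length + 1 + M * maxArity legs) →
        |gintM A f c legs χ P D| ≤ G)
    (hGs : ∀ (P : Multiset (S → ℝ)) (D : List (S → ℝ)), (∀ w ∈ P, w ∈ Dir) → (∀ z ∈ D, ∃ u ∈ Dir, A⁻¹ *ᵥ u = z) →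
      Multiset.card P + D.length ≤ ∑ j ∈ O, ((obs j).length + 1 + M * maxArity legs) → D ≠ [] →
        Real.sqrt (∫ φ : S → ℝ, (P.map fun w => φ ⬝ᵥ w).prod ^ 2 * (weight A φ * source f φ)) * Kd D ≤ Gs) :
    |remv A f c legs obs M χ [] 0 O|
      ≤ ((W : ℝ) * max B 1) ^ (∑ j ∈ O, ((obs j).length + 1 + M * maxArity legs))
        * max (cM ^ M * G) (Gs * Real.sqrt (∫ φ : S → ℝ, Sh.indicator (fun _ => (1 : ℝ)) φ * (weight A φ * source f φ))) := by
  have hm : 1 ≤ max B 1 := le_max_right B 1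
  have hm0 : 0 < max B 1 := zero_lt_one.trans_le hm
  have hμ : 0 ≤ Real.sqrt (∫ φ : S → ℝ, Sh.indicator (fun _ => (1 : ℝ)) φ * (weight A φ * source f φ)) :=
    Real.sqrt_nonneg _
  unfold remv
  -- the bound of one term
  have hterm : ∀ t ∈ (expand A f c legs obs M 0 O).filter (fun t => t.consts = 0),
      |tval A f c legs χ [] t| ≤ (max B 1) ^ (∑ j ∈ O, ((obs j).length + 1 + M * maxArity legs))
        * max (cM ^ M * G) (Gs * Real.sqrt (∫ φ : S → ℝ, Sh.indicator (fun _ => (1 : ℝ)) φ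
          * (weight A φ * source f φ))) := by
    intro t ht'
    obtain ⟨ht, hc0⟩ := Multiset.mem_filter.1 ht'
    obtain ⟨h1, h2, h3⟩ := remainder_term_bound hA hχ hK hSh hχS hB hBf hcM hcM1 hcm hobs hlegs O t ht
    have hgr : 0 < Multiset.card t.groups := Multiset.card_pos.2 (groups_ne_zero_of_consts_eq_zero hO t ht hc0)
    obtain ⟨hPdir, hDdir⟩ := expand_dir hobs hlegs _ 0 O (Nat.lt_succ_self _)
      (fun h hh => absurd hh (Multiset.notMem_zero _)) t ht
    have hsize := expand_size_le (A := A) (f := f) (c := c) (legs := legs) (obs := obs) (M := M) _ 0 O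
      (Nat.lt_succ_self _) t ht
    rw [Multiset.map_zero, Multiset.sum_zero, zero_add] at hsize
    -- the legs of the remainder components as one multiset
    have hP : ∀ w ∈ (t.groups.map fun h => (h.pend : Multiset (S → ℝ))).sum, w ∈ Dir := by
      intro w hw
      obtain ⟨h, hh, hw⟩ := mem_sum_coe hw
      exact hPdir h hh w hw
    have hsz : Multiset.card ((t.groups.map fun h => (h.pend : Multiset (S → ℝ))).sum) + t.dirs.length
        ≤ ∑ j ∈ O, ((obs j).length + 1 + M * maxArity legs) := by rw [card_sum_coe]; exact hsize
    have hΦ0 : 0 ≤ (max B 1) ^ (∑ j ∈ O, ((obs j).length + 1 + M * maxArity legs)) := pow_nonneg hm0.le _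
    by_cases hchi : 0 < Multiset.card (t.groups.filter fun g => 0 < g.nchi)
    · -- a χ′ under the integral: the shell factor
      have hD : t.dirs ≠ [] := dirs_ne_nil_of_card_pos
        (remainder_components_count (A := A) (f := f) (c := c) (legs := legs) (obs := obs) (M := M) O t ht).2.1 hchi
      have hint := h2 hchi
      have hGs' := hGs _ t.dirs hP hDdir hsz hD
      calc |tval A f c legs χ [] t|
          ≤ (max B 1) ^ (∑ j ∈ O, ((obs j).length + 1 + M * maxArity legs))
              * cM ^ (M * Multiset.card (t.groups.filter fun g => M ≤ g.nv))
              * |gintM A f c legs χ ((t.groups.map fun h => (h.pend : Multiset (S → ℝ))).sum) t.dirs| := h1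
        _ ≤ (max B 1) ^ (∑ j ∈ O, ((obs j).length + 1 + M * maxArity legs)) * 1
              * (Real.sqrt (∫ φ : S → ℝ, (((t.groups.map fun h => (h.pend : Multiset (S → ℝ))).sum).map
                  fun w => φ ⬝ᵥ w).prod ^ 2 * (weight A φ * source f φ))
                * (Kd t.dirs * Real.sqrt (∫ φ : S → ℝ, Sh.indicator (fun _ => (1 : ℝ)) φ
                  * (weight A φ * source f φ)))) :=
            mul_le_mul (mul_le_mul_of_nonneg_left (pow_le_one₀ hcM hcM1) hΦ0) hint (abs_nonneg _)
              (mul_nonneg hΦ0 zero_le_one)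
        _ = (max B 1) ^ (∑ j ∈ O, ((obs j).length + 1 + M * maxArity legs))
              * ((Real.sqrt (∫ φ : S → ℝ, (((t.groups.map fun h => (h.pend : Multiset (S → ℝ))).sum).map
                  fun w => φ ⬝ᵥ w).prod ^ 2 * (weight A φ * source f φ)) * Kd t.dirs)
                * Real.sqrt (∫ φ : S → ℝ, Sh.indicator (fun _ => (1 : ℝ)) φ * (weight A φ * source f φ))) := by
            ring
        _ ≤ (max B 1) ^ (∑ j ∈ O, ((obs j).length + 1 + M * maxArity legs))
              * (Gs * Real.sqrt (∫ φ : S → ℝ, Sh.indicator (fun _ => (1 : ℝ)) φ * (weight A φ * source f φ))) :=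
            mul_le_mul_of_nonneg_left (mul_le_mul_of_nonneg_right hGs' hμ) hΦ0
        _ ≤ _ := mul_le_mul_of_nonneg_left (le_max_right _ _) hΦ0
    · -- no χ′: a vertex-saturated remainder component, `M` coupling constants
      have hsat : 0 < Multiset.card (t.groups.filter fun g => M ≤ g.nv) := by omega
      have hpow : cM ^ (M * Multiset.card (t.groups.filter fun g => M ≤ g.nv)) ≤ cM ^ M :=
        pow_le_pow_of_le_one hcM hcM1 (Nat.le_mul_of_pos_right M hsat)
      have hint := hG _ t.dirs hP hDdir hsz
      calc |tval A f c legs χ [] t|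
          ≤ (max B 1) ^ (∑ j ∈ O, ((obs j).length + 1 + M * maxArity legs))
              * cM ^ (M * Multiset.card (t.groups.filter fun g => M ≤ g.nv))
              * |gintM A f c legs χ ((t.groups.map fun h => (h.pend : Multiset (S → ℝ))).sum) t.dirs| := h1
        _ ≤ (max B 1) ^ (∑ j ∈ O, ((obs j).length + 1 + M * maxArity legs)) * cM ^ M * G :=
            mul_le_mul (mul_le_mul_of_nonneg_left hpow hΦ0) hint (abs_nonneg _) (mul_nonneg hΦ0 (pow_nonneg hcM _))
        _ = (max B 1) ^ (∑ j ∈ O, ((obs j).length + 1 + M * maxArity legs)) * (cM ^ M * G) := mul_assoc _ _ _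
        _ ≤ _ := mul_le_mul_of_nonneg_left (le_max_left _ _) hΦ0
  refine (abs_sum_map_le_card_mul _ _ hterm).trans ?_
  have hcount : (Multiset.card ((expand A f c legs obs M 0 O).filter (fun t => t.consts = 0)) : ℝ)
      ≤ (W : ℝ) ^ ∑ j ∈ O, ((obs j).length + 1 + M * maxArity legs) :=
    (card_filter_le_real _ _).trans (by exact_mod_cast card_expand_zero_le (A := A) (f := f) (c := c) O hW)
  have hsmax : 0 ≤ max (cM ^ M * G)
      (Gs * Real.sqrt (∫ φ : S → ℝ, Sh.indicator (fun _ => (1 : ℝ)) φ * (weight A φ * source f φ))) :=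
    le_max_of_le_left (mul_nonneg (pow_nonneg hcM _) hG0)
  calc _ ≤ (W : ℝ) ^ (∑ j ∈ O, ((obs j).length + 1 + M * maxArity legs))
          * ((max B 1) ^ (∑ j ∈ O, ((obs j).length + 1 + M * maxArity legs)) * max (cM ^ M * G)
            (Gs * Real.sqrt (∫ φ : S → ℝ, Sh.indicator (fun _ => (1 : ℝ)) φ * (weight A φ * source f φ)))) :=
        mul_le_mul_of_nonneg_right hcount (mul_nonneg (pow_nonneg hm0.le _) hsmax)
    _ = _ := by rw [mul_pow]; ring


end Literature.MathematicalPhysics.QuantumFieldTheory.BalabanImbrieJaffe1984to88.BIJ88LabelledSumBounds312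

end
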